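import Summits.ValiantsHypothesis.ValiantsHypothesis.Theorems.ValuativeGCTValuativeFlipEventualInheritance
import Summits.ValiantsHypothesis.ValiantsHypothesis.Theorems.ValuativeGCTValuativeFlipPaddingTransferPoints
import Summits.ValiantsHypothesis.ValiantsHypothesis.Theorems.ValuativeGCTValuativeFlipTwistPolynomial
import HarnessLib

/-!
# Padding transfer of per-side multiplicities, II: twisted inheritance at every level and the
# eventual transfer `(n, m) ↦ (n, m + j)` (crux `ValuativeGCT.ValuativeFlip`, stmt-ValiantsHypothesis-12624)

Wall-breaker k4 (gen 1; axis "representation-stability transfer between `m` and `m + 1`"), helper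
file `--supports stmt-ValiantsHypothesis-12624`.

* Part G `twistedInheritance_padded` — the `m`-general twisted inheritance: for `n ≤ m`, `λ ⊢ m·δ`,
  highest-weight vectors `F_i` of weight `λ*` on `ℂ[Sym^m ℂ^{m²}]` and points `A_l` whose `(0,0)`-th
  column is `e_top`, a nonsingular Δ_j-twisted evaluation matrix at the `A_l · X₀₀^{m-n} per_n` gives
  `D ≤ mult_{(λ♯(m+j))*} ℂ[Δ_{m+j}(X₀₀^{m+j-n} per_n)]` (lifts `liftHWV m j`, padded points of Part F,
  `aeval_formCoeff_paddedForm_liftHWV`, engine);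
* Part H `eventualPaddingTransfer` (registered stub) — for every `n ≤ m` and `λ ⊢ m·δ` with at most
  `m²` parts, `∃ j₀, ∀ j ≥ j₀, mult_{λ*} ℂ[Δ_m(X₀₀^{m-n} per_n)] ≤ mult_{(λ♯(m+j))*} ℂ[Δ_{m+j}(X₀₀^{m+j-n} per_n)]`:
  a per-side multiplicity lower bound at ANY position `(n, m)` of the window persists at `(n, m + j)`
  for all but finitely many paddings `j` (complete certificate with prescribed column, Part E;
  polynomiality of the twist in `j` and finitely many roots, `…EventualInheritance` Parts B–C).
  Its case `m = n` (Axis S1, BLMW Problem 6.10 for cofinitely many paddings) is landed by k12 as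
  `eventualInheritance` (`…EventualInheritanceK12`, over `stub_twistedInheritance` and this seat's / k12's
  twist algebra); it is not restated here.
* Part I `paddingTransfer_exceptions_ncard_le` — the EFFECTIVE form: the set of exceptional paddings
  `j` has at most `m·δ·D` elements, `D = mult_{λ*} ℂ[Δ_m(X₀₀^{m-n} per_n)]` (the twisted certificate
  determinant is `(j!)^{δD} q(j)` with `deg q ≤ D·δ·m`, `q(0) ≠ 0`: `exists_twistedDet_poly`,
  `natDegree_twistAeval_le`, k12's `natDegree_det_le_of_forall_le`, `ncard_natRoots_le`).  (At `m = n`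
  this is k12's `exceptionalPaddings_card_le_orbitMultiplicity`.)

For the crux this is the per-side half of an `m ↦ m + j` transfer of flip witnesses in the currency
of the flip body (multiplicities); the det side `dim T_U(λ♯, m+j)` is not controlled by it, and `j₀`
is effective only in NUMBER (`≤ m·δ·D` exceptions), not in location, so no tail statement follows —
consistent with the dead-axis verdicts of the gen-0 seats for the tail.

Sources: BLMW 2011 §6.4 (Problem 6.10); Ikenmeyer–Panova 2017 Prop. 2.6(b); Bürgisser–Ikenmeyer–Panova
2019 Lemma 5.2–5.3, Thm. 5.4; Kadish–Landsberg, Commun. Algebra 42 (2014) §1; Mulmuley–Sohoni 2001 §4–5.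
-/

set_option linter.dupNamespace false

namespace Summit.ValiantsHypothesis.ValiantsHypothesis.Theorems.ValuativeFlip

open scoped BigOperators Nat Matrix
open MvPolynomial
open Literature.NumberTheory.DiophantineGeometry
open Literature.Computability.AlgebraicComplexity
open Literature.Computability.Complexity

noncomputable section

/-! ## The engine (private copy of the landed `stub_evalRankLowerBound`, siege seat k3) -/

/-- **The evaluation-certificate engine** (private copy of the registered stub
`stub_evalRankLowerBound`, landed by siege seat k3 as
`ValuativeGCTValuativeFlipEvalRankLowerBoundK3.stub_evalRankLowerBound`; copied privately, as in k12's
`…TwistedInheritance`, to keep this file's imports inside the built library).  Highest-weight vectors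
`F₁ … F_D` of weight `χ` with a nonsingular evaluation matrix at endomorphism-orbit points certify
`D ≤ mult_χ ℂ[Δ_m(f)]`. [Mulmuley–Sohoni 2001 §4–5; BLMW 2011 §5.2; folklore] -/
private theorem pet_evalRank_le_orbitMultiplicity :
    ∀ {σ : Type} [Fintype σ] [LinearOrder σ] (f : MvPolynomial σ ℂ) (m : ℕ), m ≠ 0 →
      ∀ (χ : Weight σ) (D : ℕ) (F : Fin D → MvPolynomial (DegIdx σ m) ℂ),
        (∀ i, F i ∈ highestWeightSpace (coordRep σ ℂ m) χ) →
        ∀ (A : Fin D → Matrix σ σ ℂ),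
          (Matrix.of fun i l : Fin D => MvPolynomial.aeval (formCoeff m (linSubst σ ℂ (A l) f)) (F i)).det ≠ 0 →
          D ≤ orbitMultiplicity ℂ f m χ := by
  intro σ _ _ f m hm χ D F hF A hdet
  -- the classes `[F_i]` are highest-weight vectors of weight `χ` in `ℂ[Δ_m(f)]`
  have hmk : ∀ i, (Ideal.Quotient.mk (orbitVanishingIdeal f m) (F i) : OrbitCoordRing f m) ∈
      highestWeightSpace (orbitCoordRep f m) χ := by
    intro i g hg
    rw [orbitCoordRep_apply, orbitCoordSubst_mk, ← coordRep_apply, hF i g hg]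
    rw [← Ideal.Quotient.mkₐ_eq_mk ℂ, map_smul]
  -- an element of `I(GL · f)` vanishes at `B · f` for EVERY matrix `B` (singular allowed)
  have hvan : ∀ {G : MvPolynomial (DegIdx σ m) ℂ}, G ∈ orbitVanishingIdeal f m →
      ∀ B : Matrix σ σ ℂ, aeval (formCoeff m (linSubst σ ℂ B f)) G = 0 := by
    intro G hG B
    rw [orbitVanishingIdeal_eq_ker_genericOrbitMap, RingHom.mem_ker] at hG
    have h1 := aeval_genericOrbitMap f m G B
    rw [hG, map_zero] at h1
    exact h1.symm
  -- the classes `[F_i]` are linearly independent in `ℂ[Δ_m(f)]`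
  have hli : LinearIndependent ℂ fun i =>
      (Ideal.Quotient.mk (orbitVanishingIdeal f m) (F i) : OrbitCoordRing f m) := by
    rw [Fintype.linearIndependent_iff]
    intro c hc i
    have hmem : ∑ j, c j • F j ∈ orbitVanishingIdeal f m := by
      rw [← Ideal.Quotient.eq_zero_iff_mem, ← Ideal.Quotient.mkₐ_eq_mk ℂ, map_sum]
      simp only [map_smul, Ideal.Quotient.mkₐ_eq_mk]
      exact hc
    have hvec : c ᵥ* (Matrix.of fun i l : Fin D =>
        MvPolynomial.aeval (formCoeff m (linSubst σ ℂ (A l) f)) (F i)) = 0 := by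
      funext l
      have h1 := hvan hmem (A l)
      rw [map_sum] at h1
      simp only [map_smul, smul_eq_mul] at h1
      rw [Pi.zero_apply, ← h1]
      rfl
    exact congr_fun (Matrix.eq_zero_of_vecMul_eq_zero hdet hvec) i
  -- lift to the highest-weight space
  have hv : LinearIndependent ℂ fun i =>
      (⟨Ideal.Quotient.mk (orbitVanishingIdeal f m) (F i), hmk i⟩ :
        ↥(highestWeightSpace (orbitCoordRep f m) χ)) :=
    LinearIndependent.of_comp (highestWeightSpace (orbitCoordRep f m) χ).subtype hli
  -- the highest-weight space is finite-dimensional (`m ≠ 0`)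
  haveI : FiniteDimensional ℂ ↥(highestWeightSpace (orbitCoordRep f m) χ) :=
    finiteDimensional_highestWeightSpace_orbitCoordRep_holds f hm χ
  have hcard := hv.fintype_card_le_finrank
  rw [Fintype.card_fin] at hcard
  unfold orbitMultiplicity hwMultiplicity
  exact hcard


/-! ## Part G: twisted inheritance at every level `m ≥ n` -/

/-- **Twisted inheritance for the padded permanent at level `m`** (the `m`-general form of k12's
`stub_twistedInheritance`, which is the case `m = n`).  For `n ≤ m`, a shape `λ ⊢ m·δ` with at most
`m²` parts, highest-weight vectors `F₁ … F_D` of weight `λ*` on `ℂ[Sym^m ℂ^{m²}]` and points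
`A₁ … A_D ∈ Mat_{m²}` whose `(0,0)`-th column is `e_top`: if the Δ_j-twisted evaluation matrix
`(F_i(Δ_j(A_l · X₀₀^{m-n} per_n)))_{i,l}` is nonsingular, then
`D ≤ mult_{(λ♯(m+j))*} ℂ[Δ_{m+j}(X₀₀^{m+j-n} per_n)]`.  Lifts `liftHWV m j F_i`
(`liftHWV_mem_highestWeightSpace`), padded points (Part F), values of the lifts
(`aeval_formCoeff_paddedForm_liftHWV`), engine `stub_evalRankLowerBound` (k3; private copy `pet_evalRank_le_orbitMultiplicity`).
[Ikenmeyer–Panova 2017 Prop. 2.6(b); Bürgisser–Ikenmeyer–Panova 2019 Lemma 5.2, Thm. 5.4] -/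
theorem twistedInheritance_padded (n m j δ : ℕ) [NeZero m] [NeZero (m + j)] (hnm : n ≤ m)
    (lam : Nat.Partition (m * δ)) (hlam : lam.parts.card ≤ m * m)
    (D : ℕ) (F : Fin D → MvPolynomial (DegIdx (MatIdx m) m) ℂ)
    (hF : ∀ i, F i ∈ highestWeightSpace (coordRep (MatIdx m) ℂ m) (partitionWeightLex m lam))
    (A : Fin D → Matrix (MatIdx m) (MatIdx m) ℂ)
    (hA : ∀ l s, A l s (toLex ((0 : Fin m), (0 : Fin m))) = if s = topMatIdx m then 1 else 0)
    (hdet : (Matrix.of fun i l : Fin D => aeval (fun e : DegIdx (MatIdx m) m =>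
        (((e.1 (topMatIdx m) + j).descFactorial j : ℕ) : ℂ) *
          coeff e.1 (linSubst (MatIdx m) ℂ (A l) (paddedPerFormLex ℂ n m))) (F i)).det ≠ 0) :
    D ≤ orbitMultiplicity ℂ (paddedPerFormLex ℂ n (m + j)) (m + j)
      (partitionWeightLex (m + j) (rowLift lam j)) := by
  classical
  choose M hM using fun l : Fin D =>
    exists_linSubst_paddedPerFormLex_eq_paddedForm_of_col n m j hnm (A l) (hA l)
  have hhom : ∀ l, (linSubst (MatIdx m) ℂ (A l) (paddedPerFormLex ℂ n m)).IsHomogeneous m := fun l =>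
    linSubst_isHomogeneous _ (paddedPerFormLex_isHomogeneous ℂ hnm)
  refine pet_evalRank_le_orbitMultiplicity (paddedPerFormLex ℂ n (m + j)) (m + j) (NeZero.ne (m + j))
    (partitionWeightLex (m + j) (rowLift lam j)) D (fun i => liftHWV m j (F i))
    (fun i => liftHWV_mem_highestWeightSpace lam hlam j (hF i)) M ?_
  have hmat : (Matrix.of fun i l : Fin D => MvPolynomial.aeval
        (formCoeff (m + j) (linSubst (MatIdx (m + j)) ℂ (M l) (paddedPerFormLex ℂ n (m + j)))) (liftHWV m j (F i))) =
      Matrix.of fun i l : Fin D => aeval (fun e : DegIdx (MatIdx m) m =>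
        (((e.1 (topMatIdx m) + j).descFactorial j : ℕ) : ℂ) *
          coeff e.1 (linSubst (MatIdx m) ℂ (A l) (paddedPerFormLex ℂ n m))) (F i) := by
    ext i l
    rw [Matrix.of_apply, Matrix.of_apply, hM l, aeval_formCoeff_paddedForm_liftHWV j (hhom l)]
  rw [hmat]
  exact hdet

/-! ## Part H: eventual transfer along the padding at every position `(n, m)` -/

/-- **Eventual padding transfer of per-side multiplicities** (registered stub
`eventualPaddingTransfer`).  For every position `n ≤ m` of the crux window and every shape
`λ ⊢ m·δ` with at most `m²` parts there is `j₀` such that for all `j ≥ j₀`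
`mult_{λ*} ℂ[Δ_m(X₀₀^{m-n} per_n)] ≤ mult_{(λ♯(m+j))*} ℂ[Δ_{m+j}(X₀₀^{m+j-n} per_n)]`:
a per-side multiplicity lower bound at `(n, m)` persists at `(n, m + j)` for all but finitely many
paddings `j` (the case `m = n` is Axis S1 — BLMW Problem 6.10 for cofinitely many paddings — landed
by k12 as `eventualInheritance`).  Proof: a complete certificate at level `m` with points sending `X₀₀ ↦ X_top`
(`exists_evalCertificate_col`), forms of degree `δ` (`isHomogeneous_of_mem_highestWeightSpace`),
twisted determinant `(j!)^{δD} q(j)` with `q(0) ≠ 0` (`exists_forall_twistedDet_ne_zero`), and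
twisted inheritance at level `m` (`twistedInheritance_padded`).
[BLMW 2011 §6.4 Problem 6.10; Ikenmeyer–Panova 2017 Prop. 2.6(b); Kadish–Landsberg 2014 §1] -/
theorem eventualPaddingTransfer :
    ∀ (n m δ : ℕ) [NeZero m], n ≤ m → ∀ (lam : Nat.Partition (m * δ)), lam.parts.card ≤ m * m → ∃ j₀, ∀ j ≥ j₀, ∀ [NeZero (m + j)], orbitMultiplicity ℂ (paddedPerFormLex ℂ n m) m (partitionWeightLex m lam) ≤ orbitMultiplicity ℂ (paddedPerFormLex ℂ n (m + j)) (m + j) (partitionWeightLex (m + j) (rowLift lam j)) := by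
  intro n m δ _ hnm lam hlam
  classical
  set D := orbitMultiplicity ℂ (paddedPerFormLex ℂ n m) m (partitionWeightLex m lam) with hD
  obtain ⟨F, A, hF, -, hAcol, hdet⟩ := exists_evalCertificate_col (paddedPerFormLex ℂ n m) (NeZero.ne m)
    (partitionWeightLex m lam) (toLex ((0 : Fin m), (0 : Fin m))) (topMatIdx m) (le_topMatIdx m) (le_refl D)
  have hhom : ∀ i, (F i).IsHomogeneous δ := fun i =>
    isHomogeneous_of_mem_highestWeightSpace (NeZero.ne m) (hF i) (size_partitionWeightLex' lam hlam)
  let c : Fin D → DegIdx (MatIdx m) m → ℂ := fun l e =>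
    MvPolynomial.coeff e.1 (linSubst (MatIdx m) ℂ (A l) (paddedPerFormLex ℂ n m))
  have h0 : (Matrix.of fun i l : Fin D => aeval (c l) (F i)).det ≠ 0 := by
    have : (Matrix.of fun i l : Fin D => aeval (c l) (F i)) =
        Matrix.of fun i l : Fin D => aeval (formCoeff m (linSubst (MatIdx m) ℂ (A l) (paddedPerFormLex ℂ n m))) (F i) := by
      ext i l
      rfl
    rw [this]
    exact hdet
  obtain ⟨j₀, hj₀⟩ := exists_forall_twistedDet_ne_zero (fun e : DegIdx (MatIdx m) m => e.1 (topMatIdx m))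
    F hhom c h0
  refine ⟨j₀, fun j hj _ => ?_⟩
  exact twistedInheritance_padded n m j δ hnm lam hlam D F hF A hAcol (hj₀ j hj)

/-! ## Part I: the number of exceptional paddings is at most `m · δ · D` -/

/-- Degree of the twisted evaluation polynomial: for a form `F` of degree `δ` and top exponents
`t(e) ≤ B`, `deg_X F(P_{t(e)} c_e)_e ≤ δ·B` (`deg P_e = e`). [folklore] -/
theorem natDegree_twistAeval_le {ι : Type*} (t : ι → ℕ) (c : ι → ℂ) {F : MvPolynomial ι ℂ}
    {δ B : ℕ} (hF : F.IsHomogeneous δ) (ht : ∀ e, t e ≤ B) :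
    (aeval (fun e => (Polynomial.C ((Nat.factorial (t e) : ℂ)⁻¹) *
      (ascPochhammer ℂ (t e)).comp (Polynomial.X + 1)) * Polynomial.C (c e)) F).natDegree ≤ δ * B := by
  refine natDegree_aeval_le_of_isHomogeneous hF _ fun e => ?_
  refine (Polynomial.natDegree_mul_C_le _ _).trans ((Polynomial.natDegree_C_mul_le _ _).trans ?_)
  refine Polynomial.natDegree_comp_le.trans ?_
  rw [ascPochhammer_natDegree]
  have h1 : (Polynomial.X + 1 : Polynomial ℂ).natDegree = 1 := by
    rw [← Polynomial.C_1, Polynomial.natDegree_X_add_C]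
  rw [h1, mul_one]
  exact ht e

/-- A nonzero complex polynomial has at most `deg q` natural roots. [folklore] -/
theorem ncard_natRoots_le (q : Polynomial ℂ) (hq : q ≠ 0) :
    {j : ℕ | q.eval (j : ℂ) = 0}.ncard ≤ q.natDegree := by
  classical
  have h1 : (fun j : ℕ => (j : ℂ)) '' {j : ℕ | q.eval (j : ℂ) = 0} ⊆ (q.roots.toFinset : Set ℂ) := by
    rintro _ ⟨j, hj, rfl⟩
    simp only [Finset.mem_coe, Multiset.mem_toFinset]
    exact (Polynomial.mem_roots hq).mpr hj
  calc {j : ℕ | q.eval (j : ℂ) = 0}.ncard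
        = ((fun j : ℕ => (j : ℂ)) '' {j : ℕ | q.eval (j : ℂ) = 0}).ncard :=
          (Set.ncard_image_of_injective _ Nat.cast_injective).symm
    _ ≤ (q.roots.toFinset : Set ℂ).ncard := Set.ncard_le_ncard h1 (Finset.finite_toSet _)
    _ = q.roots.toFinset.card := Set.ncard_coe_finset _
    _ ≤ Multiset.card q.roots := Multiset.toFinset_card_le _
    _ ≤ q.natDegree := Polynomial.card_roots' q

/-- **The twisted certificate determinant as an explicit polynomial in the padding.**  For forms
`F_i` of degree `δ`, coefficient vectors `c_l` and top exponents `t(e) ≤ B`: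
`det (F_i((t(e)+j).descFactorial j · c_{l,e}))_{i,l} = (j!)^{δD} q(j)` for a polynomial `q` of degree
`≤ D·δ·B` with `q(0) = det (F_i(c_l))`. [folklore] -/
theorem exists_twistedDet_poly {ι : Type*} (t : ι → ℕ) {D δ B : ℕ}
    (F : Fin D → MvPolynomial ι ℂ) (hF : ∀ i, (F i).IsHomogeneous δ) (ht : ∀ e, t e ≤ B)
    (c : Fin D → ι → ℂ) :
    ∃ q : Polynomial ℂ, q.natDegree ≤ D * (δ * B) ∧
      q.eval 0 = (Matrix.of fun i l : Fin D => aeval (c l) (F i)).det ∧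
      ∀ j : ℕ, (Matrix.of fun i l : Fin D =>
        aeval (fun e => (((t e + j).descFactorial j : ℕ) : ℂ) * c l e) (F i)).det =
        (((j ! : ℕ) : ℂ) ^ δ) ^ D * q.eval (j : ℂ) := by
  classical
  let P : Matrix (Fin D) (Fin D) (Polynomial ℂ) :=
    Matrix.of fun i l : Fin D => aeval (fun e => (Polynomial.C ((Nat.factorial (t e) : ℂ)⁻¹) *
      (ascPochhammer ℂ (t e)).comp (Polynomial.X + 1)) * Polynomial.C (c l e)) (F i)
  refine ⟨P.det, natDegree_det_le_of_forall_le P fun i l => natDegree_twistAeval_le t (c l) (hF i) ht, ?_, ?_⟩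
  · rw [← Polynomial.coe_evalRingHom, RingHom.map_det]
    congr 1
    ext i l
    simp only [RingHom.mapMatrix_apply, Matrix.map_apply, Matrix.of_apply, Polynomial.coe_evalRingHom, P]
    exact eval_zero_twistAeval t (c l) (F i)
  · intro j
    have hM : (Matrix.of fun i l : Fin D =>
        aeval (fun e => (((t e + j).descFactorial j : ℕ) : ℂ) * c l e) (F i)) =
        (((j ! : ℕ) : ℂ) ^ δ) • (Polynomial.evalRingHom (j : ℂ)).mapMatrix P := by
      ext i l
      simp only [Matrix.of_apply, Matrix.smul_apply, smul_eq_mul, RingHom.mapMatrix_apply,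
        Matrix.map_apply, Polynomial.coe_evalRingHom, P]
      exact twisted_aeval_eq_pow_mul_eval t (c l) (hF i) j
    rw [hM, Matrix.det_smul, Fintype.card_fin, ← RingHom.map_det, Polynomial.coe_evalRingHom]

/-- **At most `m·δ·D` exceptional paddings.**  For `n ≤ m` and `λ ⊢ m·δ` with at most `m²` parts,
the set of paddings `j` at which the per-side multiplicity `D = mult_{λ*} ℂ[Δ_m(X₀₀^{m-n} per_n)]`
FAILS to be inherited by `mult_{(λ♯(m+j))*} ℂ[Δ_{m+j}(X₀₀^{m+j-n} per_n)]` has at most `m·δ·D`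
elements: it lies in the natural zero set of the polynomial `q` of `exists_twistedDet_poly`
(`deg q ≤ D·δ·m`, `q(0) ≠ 0`; top exponents are `≤ m`).  An effective form of
`eventualPaddingTransfer` at every level `m ≥ n` (the case `m = n` is k12's
`exceptionalPaddings_card_le_orbitMultiplicity`). [BLMW 2011 §6.4 Problem 6.10; Ikenmeyer–Panova 2017 Prop. 2.6(b)] -/
theorem paddingTransfer_exceptions_ncard_le :
    ∀ (n m δ : ℕ) [NeZero m], n ≤ m → ∀ (lam : Nat.Partition (m * δ)), lam.parts.card ≤ m * m → {j : ℕ | ∀ [NeZero (m + j)], ¬ (orbitMultiplicity ℂ (paddedPerFormLex ℂ n m) m (partitionWeightLex m lam) ≤ orbitMultiplicity ℂ (paddedPerFormLex ℂ n (m + j)) (m + j) (partitionWeightLex (m + j) (rowLift lam j)))}.ncard ≤ m * δ * orbitMultiplicity ℂ (paddedPerFormLex ℂ n m) m (partitionWeightLex m lam) := by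
  intro n m δ _ hnm lam hlam
  classical
  set D := orbitMultiplicity ℂ (paddedPerFormLex ℂ n m) m (partitionWeightLex m lam) with hD
  obtain ⟨F, A, hF, -, hAcol, hdet⟩ := exists_evalCertificate_col (paddedPerFormLex ℂ n m) (NeZero.ne m)
    (partitionWeightLex m lam) (toLex ((0 : Fin m), (0 : Fin m))) (topMatIdx m) (le_topMatIdx m) (le_refl D)
  have hhom : ∀ i, (F i).IsHomogeneous δ := fun i =>
    isHomogeneous_of_mem_highestWeightSpace (NeZero.ne m) (hF i) (size_partitionWeightLex' lam hlam)
  let c : Fin D → DegIdx (MatIdx m) m → ℂ := fun l e =>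
    MvPolynomial.coeff e.1 (linSubst (MatIdx m) ℂ (A l) (paddedPerFormLex ℂ n m))
  have ht : ∀ e : DegIdx (MatIdx m) m, e.1 (topMatIdx m) ≤ m := by
    intro e
    have he : e.1.degree = m := mem_degMonomials_iff.mp e.2
    exact (Finsupp.le_degree _ _).trans he.le
  obtain ⟨q, hqdeg, hq0, hqj⟩ := exists_twistedDet_poly (fun e : DegIdx (MatIdx m) m => e.1 (topMatIdx m))
    F hhom ht c
  have hq0' : q.eval 0 ≠ 0 := by
    rw [hq0]
    have : (Matrix.of fun i l : Fin D => aeval (c l) (F i)) =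
        Matrix.of fun i l : Fin D => aeval (formCoeff m (linSubst (MatIdx m) ℂ (A l) (paddedPerFormLex ℂ n m))) (F i) := by
      ext i l
      rfl
    rw [this]
    exact hdet
  have hq : q ≠ 0 := fun h => hq0' (by rw [h, Polynomial.eval_zero])
  -- the exceptional set lies in the natural zero set of `q`
  have hsub : {j : ℕ | ∀ [NeZero (m + j)], ¬ (orbitMultiplicity ℂ (paddedPerFormLex ℂ n m) m (partitionWeightLex m lam) ≤
      orbitMultiplicity ℂ (paddedPerFormLex ℂ n (m + j)) (m + j) (partitionWeightLex (m + j) (rowLift lam j)))} ⊆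
      {j : ℕ | q.eval (j : ℂ) = 0} := by
    intro j hj
    by_contra hne
    apply hj
    rw [← hD]
    refine twistedInheritance_padded n m j δ hnm lam hlam D F hF A hAcol ?_
    rw [hqj j]
    refine mul_ne_zero (pow_ne_zero _ (pow_ne_zero _ ?_)) hne
    exact_mod_cast Nat.factorial_ne_zero j
  calc _ ≤ {j : ℕ | q.eval (j : ℂ) = 0}.ncard :=
        Set.ncard_le_ncard hsub ((Polynomial.finite_setOf_isRoot hq).preimage Nat.cast_injective.injOn)
    _ ≤ q.natDegree := ncard_natRoots_le q hq
    _ ≤ D * (δ * m) := hqdeg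
    _ = m * δ * D := by ring

/-- **One threshold for all shapes of a given degree.**  Since there are finitely many `λ ⊢ m·δ`,
`eventualPaddingTransfer` holds with a single `j₀(n, m, δ)`: for all `j ≥ j₀` and EVERY `λ ⊢ m·δ` with
at most `m²` parts, `mult_{λ*} ℂ[Δ_m(X₀₀^{m-n} per_n)] ≤ mult_{(λ♯(m+j))*} ℂ[Δ_{m+j}(X₀₀^{m+j-n} per_n)]` —
the whole degree-`δ` isotypic profile of the per side at `(n, m)` is dominated by that at `(n, m + j)`
along `λ ↦ λ♯`. [BLMW 2011 §6.4; folklore] -/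
theorem eventualPaddingTransfer_uniform (n m δ : ℕ) [NeZero m] (hnm : n ≤ m) :
    ∃ j₀, ∀ j ≥ j₀, ∀ [NeZero (m + j)], ∀ lam : Nat.Partition (m * δ), lam.parts.card ≤ m * m →
      orbitMultiplicity ℂ (paddedPerFormLex ℂ n m) m (partitionWeightLex m lam) ≤
        orbitMultiplicity ℂ (paddedPerFormLex ℂ n (m + j)) (m + j) (partitionWeightLex (m + j) (rowLift lam j)) := by
  classical
  have h : ∀ lam : Nat.Partition (m * δ), ∃ j₀ : ℕ, lam.parts.card ≤ m * m → ∀ j ≥ j₀, ∀ [NeZero (m + j)],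
      orbitMultiplicity ℂ (paddedPerFormLex ℂ n m) m (partitionWeightLex m lam) ≤
        orbitMultiplicity ℂ (paddedPerFormLex ℂ n (m + j)) (m + j) (partitionWeightLex (m + j) (rowLift lam j)) := by
    intro lam
    by_cases hlam : lam.parts.card ≤ m * m
    · obtain ⟨j₀, hj₀⟩ := eventualPaddingTransfer n m δ hnm lam hlam
      exact ⟨j₀, fun _ => hj₀⟩
    · exact ⟨0, fun h' => absurd h' hlam⟩
  choose j₀ hj₀ using h
  refine ⟨Finset.univ.sup j₀, fun j hj _ lam hlam => ?_⟩
  exact hj₀ lam hlam j ((Finset.le_sup (Finset.mem_univ lam)).trans hj)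

end

end Summit.ValiantsHypothesis.ValiantsHypothesis.Theorems.ValuativeFlip
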